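import Mathlib.Algebra.Order.Group.PosPart
import Mathlib.Analysis.Normed.Field.Basic
import Mathlib.Algebra.BigOperators.Ring.Finset
import Mathlib.Data.Real.Basic
import Mathlib.Tactic.LinearCombination
import Mathlib.Tactic.Linarith
import Mathlib.Tactic.Ring
import HarnessLib

/-!
# Symmetric matrices as combinations of the `n²` standard dyads (the algebraic core of the
# Motzkin–Wasow lemma, Gilbarg–Trudinger Lemma 17.13)

For a symmetric real `n × n` array `a` and any array `h`, the trace pairing decomposes along
the directions `e_i` and `e_i ± e_j`:

`Σ_{ij} a_ij h_ij = Σ_i (a_ii − Σ_{j≠i}|a_ij|) h_ii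
   + Σ_{i≠j} ½[(a_ij)⁺ (h_ii + h_jj + h_ij + h_ji) + (a_ij)⁻ (h_ii + h_jj − h_ij − h_ji)]`

(`dyadic_pairing`), i.e. `a = Σ_i c_i e_i⊗e_i + Σ_{i≠j} ½[(a_ij)⁺(e_i+e_j)⊗(e_i+e_j) +
(a_ij)⁻(e_i−e_j)⊗(e_i−e_j)]` tested against `h`; for `h = D²u` the brackets are the pure second
derivatives `D_{γγ}u`, `γ = e_i ± e_j`. All coefficients are `≥ 0` exactly when `a` is
diagonally dominant (`dyadic_coeff_nonneg_of_dominant`), which is how the Motzkin–Wasow lemma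
(every `𝒜 ∈ S[λ,Λ]` is `Σ β_k γ_k⊗γ_k` over a FIXED finite set of directions with
`λ* ≤ β_k ≤ Λ*`) is reduced to near-diagonalisation in a finite net of orthonormal frames.

## References

* D. Gilbarg, N. S. Trudinger, *Elliptic Partial Differential Equations of Second Order* (2001),
  Lemma 17.13 and its proof, pp. 456, 462. [GilbargTrudinger2001]
* T. S. Motzkin, W. Wasow, J. Math. Phys. 31 (1953) 253–259. [MotzkinWasow1953]
-/

noncomputable section

open Finset

namespace Literature.Analysis.Matrix.MotzkinWasow

variable {ι : Type*} [Fintype ι] [DecidableEq ι]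

/-- **Dyadic decomposition of the trace pairing** (algebraic core of the Motzkin–Wasow lemma):
for a symmetric array `a` and any array `h`,
`Σ_{ij} a_ij h_ij = Σ_i (a_ii − Σ_{j≠i}|a_ij|) h_ii
  + Σ_i Σ_{j≠i} ½[(a_ij)⁺(h_ii + h_jj + h_ij + h_ji) + (a_ij)⁻(h_ii + h_jj − h_ij − h_ji)]`.
[cite: GilbargTrudinger2001, Lemma 17.13 (proof, the matrix `𝒜₀`)] -/
theorem dyadic_pairing (a h : ι → ι → ℝ) (ha : ∀ i j, a i j = a j i) :
    ∑ i, ∑ j, a i j * h i j =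
      ∑ i, (a i i - ∑ j ∈ univ.erase i, |a i j|) * h i i +
      ∑ i, ∑ j ∈ univ.erase i, (1 / 2 : ℝ) *
        ((a i j)⁺ * (h i i + h j j + h i j + h j i) + (a i j)⁻ * (h i i + h j j - h i j - h j i)) := by
  -- rewrite the bracket through `a⁺ + a⁻ = |a|`, `a⁺ − a⁻ = a`
  have hbr : ∀ i j, (1 / 2 : ℝ) *
      ((a i j)⁺ * (h i i + h j j + h i j + h j i) + (a i j)⁻ * (h i i + h j j - h i j - h j i)) =
      (1 / 2 : ℝ) * (|a i j| * h i i) + (1 / 2 : ℝ) * (|a i j| * h j j) +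
        ((1 / 2 : ℝ) * (a i j * h i j) + (1 / 2 : ℝ) * (a i j * h j i)) := by
    intro i j
    rw [← posPart_add_negPart (a i j)]
    linear_combination ((1 / 2 : ℝ) * (h i j + h j i)) * posPart_sub_negPart (a i j)
  simp_rw [hbr]
  -- name the atoms (full double sums) and convert the `erase`-sums
  have hE : ∀ (f : ι → ι → ℝ) (i : ι), ∑ j ∈ univ.erase i, f i j = ∑ j, f i j - f i i :=
    fun f i ↦ Finset.sum_erase_eq_sub (mem_univ i)
  -- swapped atoms
  have hU : ∑ i, ∑ j, (1 / 2 : ℝ) * (|a i j| * h j j) = ∑ i, ∑ j, (1 / 2 : ℝ) * (|a i j| * h i i) := by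
    rw [Finset.sum_comm]
    exact Finset.sum_congr rfl fun i _ ↦ Finset.sum_congr rfl fun j _ ↦ by rw [ha]
  have hV : ∑ i, ∑ j, (1 / 2 : ℝ) * (a i j * h j i) = ∑ i, ∑ j, (1 / 2 : ℝ) * (a i j * h i j) := by
    rw [Finset.sum_comm]
    exact Finset.sum_congr rfl fun i _ ↦ Finset.sum_congr rfl fun j _ ↦ by rw [ha]
  -- expand the right-hand side into atoms
  have hR2 : ∑ i, ∑ j ∈ univ.erase i,
      ((1 / 2 : ℝ) * (|a i j| * h i i) + (1 / 2 : ℝ) * (|a i j| * h j j) +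
        ((1 / 2 : ℝ) * (a i j * h i j) + (1 / 2 : ℝ) * (a i j * h j i))) =
      (∑ i, ∑ j, (1 / 2 : ℝ) * (|a i j| * h i i) + ∑ i, ∑ j, (1 / 2 : ℝ) * (|a i j| * h j j) +
        (∑ i, ∑ j, (1 / 2 : ℝ) * (a i j * h i j) + ∑ i, ∑ j, (1 / 2 : ℝ) * (a i j * h j i))) -
      ∑ i, (|a i i| * h i i + a i i * h i i) := by
    rw [Finset.sum_congr rfl fun i _ ↦ hE (fun i j ↦ (1 / 2 : ℝ) * (|a i j| * h i i) +
      (1 / 2 : ℝ) * (|a i j| * h j j) + ((1 / 2 : ℝ) * (a i j * h i j) + (1 / 2 : ℝ) * (a i j * h j i))) i,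
      Finset.sum_sub_distrib]
    congr 1
    · simp only [Finset.sum_add_distrib]
    · exact Finset.sum_congr rfl fun i _ ↦ by ring
  have hR1 : ∑ i, (a i i - ∑ j ∈ univ.erase i, |a i j|) * h i i =
      ∑ i, a i i * h i i - ∑ i, ∑ j, |a i j| * h i i + ∑ i, |a i i| * h i i := by
    rw [← Finset.sum_sub_distrib, ← Finset.sum_add_distrib]
    refine Finset.sum_congr rfl fun i _ ↦ ?_
    rw [hE (fun i j ↦ |a i j|) i, ← Finset.sum_mul]
    ring
  -- the left-hand side split is not needed: compare atoms directly
  rw [hR1, hR2, hU, hV]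
  have hT : ∑ i, ∑ j, (1 / 2 : ℝ) * (|a i j| * h i i) = (1 / 2 : ℝ) * ∑ i, ∑ j, |a i j| * h i i := by
    rw [Finset.mul_sum]
    exact Finset.sum_congr rfl fun i _ ↦ by rw [Finset.mul_sum]
  have hS : ∑ i, ∑ j, (1 / 2 : ℝ) * (a i j * h i j) = (1 / 2 : ℝ) * ∑ i, ∑ j, a i j * h i j := by
    rw [Finset.mul_sum]
    exact Finset.sum_congr rfl fun i _ ↦ by rw [Finset.mul_sum]
  have hD : ∑ i, (|a i i| * h i i + a i i * h i i) = ∑ i, |a i i| * h i i + ∑ i, a i i * h i i :=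
    Finset.sum_add_distrib
  rw [hT, hS, hD]
  ring

/-- **The coefficients are nonnegative for a diagonally dominant array**: if
`Σ_{j≠i} |a_ij| ≤ a_ii − m` for all `i`, the diagonal coefficients are `≥ m` and the
off-diagonal ones `(a_ij)^± ≥ 0`. [cite: GilbargTrudinger2001, Lemma 17.13 (proof)] -/
theorem dyadic_coeff_nonneg_of_dominant (a : ι → ι → ℝ) {m : ℝ}
    (hdom : ∀ i, ∑ j ∈ univ.erase i, |a i j| ≤ a i i - m) (i j : ι) :
    m ≤ a i i - ∑ j ∈ univ.erase i, |a i j| ∧ 0 ≤ (a i j)⁺ ∧ 0 ≤ (a i j)⁻ :=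
  ⟨by linarith [hdom i], posPart_nonneg _, negPart_nonneg _⟩

omit [Fintype ι] [DecidableEq ι] in
/-- **Pure second differences along `e_i ± e_j`**: for a symmetric `h` (e.g. a Hessian) the
brackets of `dyadic_pairing` are `(e_i ± e_j)ᵀ h (e_i ± e_j) = h_ii + h_jj ± 2h_ij`.
[folklore] -/
theorem bracket_eq_of_symm (h : ι → ι → ℝ) (hh : ∀ i j, h i j = h j i) (i j : ι) :
    h i i + h j j + h i j + h j i = h i i + h j j + 2 * h i j ∧
      h i i + h j j - h i j - h j i = h i i + h j j - 2 * h i j := by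
  constructor <;> (rw [hh j i]; ring)

end Literature.Analysis.Matrix.MotzkinWasow

end
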